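import Literature.MathematicalPhysics.QuantumFieldTheory.Balaban1983to89.B8Prop5TraceFree

/-!
# `Balaban1983to89.B8TraceLogProduct` — [Balaban1985Averaging] (28)–(33) pp. 22–23 read under a TRACE: for every continuous tracial
# functional `τ` on a Banach algebra, `τ(log(eᵃeᵇ)) = τ(a) + τ(b)` for `‖a‖ + ‖b‖ ≤ ½` — the hypothesis (T2) of `B8Prop5TraceFree` ∕
# `B8Prop5GaugeParamTraceFree` ∕ `B8Prop5JoinSectELocalRDTraceFree` (joint J-SU of sub-row «G-B8-T2S») DISCHARGED from (T1) `τ(xy) = τ(yx)` alone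

statement-level skeleton of published theorems with citation tags; proofs where landed; nothing here is a claim about the
Yang–Mills mass gap

T. Bałaban, *Averaging operations for lattice gauge theories*, Commun. Math. Phys. **98** (1985) 17–51 `[Balaban1985Averaging]` ("[3]"):
(28)–(33) pp. 22–23 — `Z(u) = log e^{uX}e^{Y}` is analytic, and along a differentiable path `e^{−A(t)}(e^{A})′(t) = g(ad_{A(t)})A′(t)` with
`g(T) = Σ (−T)ⁿ/(n+1)!` ((32)–(33)).  T. Bałaban, *Spaces of regular gauge field configurations …*, Commun. Math. Phys. **99** (1985) 75–102
`[Balaban1985RegularSpaces]` ("B8"), p. 76 and (1.17) p. 78 (`𝔤`-valued gauge parameters).  STATUS: published, refereed.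

CITATION HEADER (lean-in-tree rule).  Cell `lit-balaban`, seat `lit-balaban-t2s-1` (gen 0), sub-row «G-B8-T2S» (R3 `stmt-QuantumFields-19200`),
JOINT J-SU layer 3a.  WHAT IS REPRODUCED.  The trace-free thread of this seat (`B8Prop5TraceFree.propFive_fixedPoint_kLevel_traceFree` and its
two upper storeys) carries the displayed hypothesis (T2) «`τ(mlog(exp a * exp b)) = τ a + τ b` for `‖a‖ + ‖b‖ ≤ ½`».  THIS FILE proves it for
EVERY continuous `ℂ`-linear `τ` with (T1) `τ(xy) = τ(yx)`, in any C⋆-algebra — the setting of the thread: along the path `γ(u) = e^{ua}e^{ub}` (`|u| < 13/12`,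
where `‖γ(u) − 1‖ < 1` so that `A(u) = log γ(u)` is the series (21) and is holomorphic — `Literature.Analysis.Complex.differentiableOn_logOnePlus_comp`),
[3] (32) gives `e^{−A}(e^{A})′ = g(ad_A)A′` (`Literature.Analysis.Calculus.ExpDifferential.exp_neg_mul_deriv_exp_comp`), whose trace is `τ(A′)`
(`B8Prop5TraceFree.apply_gSer_ad`: every positive power of `ad` is a commutator), while `τ(e^{−A}(e^{A})′) = τ(γ⁻¹γ′) = τ(a) + τ(b)` by
cyclicity; so `u ↦ τ(A(u)) − u(τa + τb)` has zero derivative on the disc and `τ(log(eᵃeᵇ)) = τ(a) + τ(b)` (`log 1 = 0`).  For `M_N(ℂ)`, `τ = tr`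
this is `det(eᵃeᵇ) = e^{tr a + tr b}` read through `log`; here no determinant is used.
* `norm_exp_smul_mul_exp_smul_sub_one_lt` — the radius bookkeeping `‖e^{ua}e^{ub} − 1‖ < 1` for `|u| < 13/12`, `‖a‖ + ‖b‖ ≤ ½`;
* ★ **`apply_mlog_exp_mul_exp`** — `τ(mlog(exp a * exp b)) = τ a + τ b`;
* `hlog_of_tracial` — the hypothesis (T2) of the trace-free thread, in its displayed shape, from (T1).

HONEST SCOPE.  Elementary calculus in a Banach algebra; nothing of [3] ∕ [B8] beyond the cited identities is claimed.  Count-neutral; N05 ∕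
`stub_PV3A` NOT discharged; nothing continuum ∕ ℝ⁴ ∕ OS ∕ mass-gap ∕ Clay.  No `sorry`, no `def`, no `… : Prop` fact, no `instance`, no `notation`.
-/

noncomputable section

open NormedSpace Metric Set Filter Topology
open Complex (I)

namespace Literature.MathematicalPhysics.QuantumFieldTheory.Balaban1983to89.B8TraceLogProduct

open Literature.Analysis.Calculus.ExpDifferential (ad gSer exp_neg_mul_deriv_exp_comp exp_neg_mul_exp_eq_one exp_mul_exp_neg_eq_one)
open Literature.Analysis.Complex (logOnePlus differentiableOn_logOnePlus_comp)
open MatrixLog (mlog mlog_def exp_mlog mlog_one)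
open B7Eq38Remainder (norm_exp_mul_exp_sub_one_le)
open B8Prop5TraceFree (apply_gSer_ad)

variable {𝔸 : Type*} [CStarAlgebra 𝔸]

/-- Radius bookkeeping: for `‖a‖ + ‖b‖ ≤ ½` and `|u| < 13/12`, `‖e^{ua}e^{ub} − 1‖ < 1` (so `log` is the series (21) there).
[cite: Balaban1985Averaging, (21) p.21, (28) p.22] -/
theorem norm_exp_smul_mul_exp_smul_sub_one_lt {a b : 𝔸} (hab : ‖a‖ + ‖b‖ ≤ 1 / 2) {u : ℂ} (hu : ‖u‖ < 13 / 12) :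
    ‖exp (u • a) * exp (u • b) - 1‖ < 1 := by
  have h1 := norm_exp_mul_exp_sub_one_le (u • a) (u • b)
  set x : ℝ := ‖u • a‖ + ‖u • b‖ with hx
  have hx0 : 0 ≤ x := by positivity
  have hx1 : x ≤ 13 / 24 := by
    rw [hx, norm_smul, norm_smul, ← mul_add]
    calc ‖u‖ * (‖a‖ + ‖b‖) ≤ 13 / 12 * (1 / 2) := by
          apply mul_le_mul hu.le hab (by positivity) (by norm_num)
      _ = 13 / 24 := by norm_num
  have h2 : Real.exp x ≤ 1 + x + x ^ 2 := by
    have := (abs_le.mp (Real.abs_exp_sub_one_sub_id_le (x := x) (abs_le.mpr ⟨by linarith, by linarith⟩))).2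
    linarith
  have h3 : x + x ^ 2 < 1 := by nlinarith
  linarith

/-- ★ **`τ(log(eᵃeᵇ)) = τ(a) + τ(b)`** for every continuous `ℂ`-linear TRACIAL `τ` (`τ(xy) = τ(yx)`) and `‖a‖ + ‖b‖ ≤ ½`: along
`γ(u) = e^{ua}e^{ub}`, `A = log γ` is holomorphic on `|u| < 13/12`, [3] (32) `e^{−A}(e^{A})′ = g(ad_A)A′` has trace `τ(A′)` (the `ad`-powers are
commutators) and equals `γ⁻¹γ′`, of trace `τ(a) + τ(b)` (cyclicity); hence `τ(A(u)) − u(τa + τb)` is constant, `= 0` at `u = 0`.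
[cite: Balaban1985Averaging, (28)–(33) pp.22–23; Balaban1985RegularSpaces, (1.17) p.78] -/
theorem apply_mlog_exp_mul_exp (τ : 𝔸 →L[ℂ] ℂ) (hτ : ∀ x y : 𝔸, τ (x * y) = τ (y * x)) {a b : 𝔸} (hab : ‖a‖ + ‖b‖ ≤ 1 / 2) :
    τ (mlog (exp a * exp b)) = τ a + τ b := by
  set s : Set ℂ := ball (0 : ℂ) (13 / 12) with hs_def
  have hs : IsOpen s := isOpen_ball
  have hs' : IsPreconnected s := (convex_ball (0 : ℂ) (13 / 12)).isPreconnected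
  -- the path `γ(u) = e^{ua}e^{ub}` and its derivative
  set γ : ℂ → 𝔸 := fun u => exp (u • a) * exp (u • b) with hγ
  have hγ1 : ∀ u ∈ s, ‖γ u - 1‖ < 1 := fun u hu =>
    norm_exp_smul_mul_exp_smul_sub_one_lt hab (mem_ball_zero_iff.1 hu)
  have hγd : ∀ u : ℂ, HasDerivAt γ (exp (u • a) * a * exp (u • b) + exp (u • a) * (exp (u • b) * b)) u :=
    fun u => (hasDerivAt_exp_smul_const a u).mul (hasDerivAt_exp_smul_const b u)
  -- `A = log γ` is holomorphic on the disc, and `e^{A} = γ` there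
  set A : ℂ → 𝔸 := fun u => mlog (γ u) with hA_def
  have hAd : DifferentiableOn ℂ A s := by
    have hW : DifferentiableOn ℂ (fun u => γ u - 1) s := fun u _ =>
      ((hγd u).differentiableAt.sub_const 1).differentiableWithinAt
    have h := differentiableOn_logOnePlus_comp hW hγ1
    refine h.congr fun u _ => ?_
    show mlog (γ u) = logOnePlus (γ u - 1)
    rw [mlog_def]
  have hexpA : ∀ u ∈ s, exp (A u) = γ u := fun u hu => exp_mlog (hγ1 u hu)
  -- the derivative identity `τ(A′(u)) = τ(a) + τ(b)`
  have hderiv : ∀ u ∈ s, τ (deriv A u) = τ a + τ b := by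
    intro u hu
    have hA : HasDerivAt A (deriv A u) u := (hAd.differentiableAt (hs.mem_nhds hu)).hasDerivAt
    have h1 := exp_neg_mul_deriv_exp_comp hA
    have hEq : (fun t => exp (A t)) =ᶠ[𝓝 u] γ :=
      Filter.eventuallyEq_of_mem (hs.mem_nhds hu) fun t ht => hexpA t ht
    have h2 : deriv (fun t => exp (A t)) u = exp (u • a) * a * exp (u • b) + exp (u • a) * (exp (u • b) * b) := by
      rw [hEq.deriv_eq]; exact (hγd u).deriv
    have h3 : τ (deriv A u) = τ (exp (-A u) * deriv (fun t => exp (A t)) u) := by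
      rw [h1, apply_gSer_ad τ hτ]
    -- `e^{−A}γ = 1` and `e^{ub}e^{−A}e^{ua} = 1`
    have hγu : γ u = exp (u • a) * exp (u • b) := rfl
    have hE : exp (-A u) * γ u = 1 := by
      rw [← hexpA u hu]; exact exp_neg_mul_exp_eq_one (𝕂 := ℂ) (A u)
    have hQEP : exp (u • b) * exp (-A u) * exp (u • a) = 1 := by
      have h4 : exp (u • b) = exp (-(u • a)) * exp (A u) := by
        rw [hexpA u hu, hγu, ← mul_assoc, exp_neg_mul_exp_eq_one (𝕂 := ℂ), one_mul]
      rw [h4, mul_assoc (exp (-(u • a))) (exp (A u)) (exp (-A u)), exp_mul_exp_neg_eq_one (𝕂 := ℂ), mul_one,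
        exp_neg_mul_exp_eq_one (𝕂 := ℂ)]
    have t2 : exp (-A u) * (exp (u • a) * (exp (u • b) * b)) = b := by
      calc exp (-A u) * (exp (u • a) * (exp (u • b) * b)) = exp (-A u) * γ u * b := by rw [hγu]; simp only [mul_assoc]
        _ = b := by rw [hE, one_mul]
    have t1 : τ (exp (-A u) * (exp (u • a) * a * exp (u • b))) = τ a := by
      calc τ (exp (-A u) * (exp (u • a) * a * exp (u • b)))
          = τ ((exp (-A u) * exp (u • a)) * (a * exp (u • b))) := by
            congr 1; simp only [mul_assoc]
        _ = τ ((a * exp (u • b)) * (exp (-A u) * exp (u • a))) := hτ _ _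
        _ = τ (a * (exp (u • b) * exp (-A u) * exp (u • a))) := by
            congr 1; simp only [mul_assoc]
        _ = τ a := by rw [hQEP, mul_one]
    rw [h3, h2, mul_add, map_add, t1, t2]
  -- `f(u) = τ(A(u)) − u(τa + τb)` has zero derivative on the disc
  set f : ℂ → ℂ := fun u => τ (A u) - u * (τ a + τ b) with hf_def
  have hfd : DifferentiableOn ℂ f s :=
    (τ.differentiable.comp_differentiableOn hAd).sub ((differentiable_id.mul_const _).differentiableOn)
  have hf' : s.EqOn (deriv f) 0 := by
    intro u hu
    have hA : HasDerivAt A (deriv A u) u := (hAd.differentiableAt (hs.mem_nhds hu)).hasDerivAt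
    have hτA : HasDerivAt (fun t => τ (A t)) (τ (deriv A u)) u := τ.hasFDerivAt.comp_hasDerivAt u hA
    have hlin : HasDerivAt (fun t : ℂ => t * (τ a + τ b)) (τ a + τ b) u := hasDerivAt_mul_const _
    have hfu : HasDerivAt f (τ (deriv A u) - (τ a + τ b)) u := hτA.sub hlin
    rw [Pi.zero_apply, hfu.deriv, hderiv u hu, sub_self]
  have h0 : (0 : ℂ) ∈ s := mem_ball_self (by norm_num)
  have h1 : (1 : ℂ) ∈ s := by rw [hs_def, mem_ball_zero_iff, norm_one]; norm_num
  have h01 := hs.is_const_of_deriv_eq_zero hs' hfd hf' h1 h0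
  -- read off at `u = 1` and `u = 0`
  have hf1 : f 1 = τ (mlog (exp a * exp b)) - (τ a + τ b) := by
    simp only [hf_def, hA_def, hγ, one_smul, one_mul]
  have hf0 : f 0 = 0 := by
    simp only [hf_def, hA_def, hγ, zero_smul, exp_zero, mul_one, mlog_one, map_zero, zero_mul, sub_zero]
  rw [hf1, hf0] at h01
  exact sub_eq_zero.1 h01

/-- **(T2) of the trace-free thread, discharged**: the displayed hypothesis `hlog` of `B8Prop5TraceFree.propFive_fixedPoint_kLevel_traceFree`,
`B8Prop5GaugeParamTraceFree.gaugeParam_kLevel_traceFree` and `B8Prop5JoinSectELocalRDTraceFree.hFP_kLevel_of179_local_RD_traceFree` holds for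
every continuous tracial `τ`. [cite: Balaban1985Averaging, (28)–(33) pp.22–23] -/
theorem hlog_of_tracial (τ : 𝔸 →L[ℂ] ℂ) (hτ : ∀ x y : 𝔸, τ (x * y) = τ (y * x)) :
    ∀ a b : 𝔸, ‖a‖ + ‖b‖ ≤ 1 / 2 → τ (mlog (exp a * exp b)) = τ a + τ b :=
  fun _ _ hab => apply_mlog_exp_mul_exp τ hτ hab

#print axioms apply_mlog_exp_mul_exp

end Literature.MathematicalPhysics.QuantumFieldTheory.Balaban1983to89.B8TraceLogProduct

end
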